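import Literature.AlgebraicGeometry.Resolution.GeneralizedStabilityReductionProofs
import Literature.AlgebraicGeometry.Resolution.GeneralizedStabilityRankOneVTReduced
import Literature.AlgebraicGeometry.Resolution.GeneralizedStabilityRankOneRTAssembly
import Literature.AlgebraicGeometry.Resolution.HenselizedRationalArtinSchreier
import Literature.AlgebraicGeometry.Resolution.GaloisDegreePDefectless
import Literature.AlgebraicGeometry.Resolution.GeneralizedStabilityTrdegOneProofs
import Literature.AlgebraicGeometry.Resolution.GeneralizedStabilityHenselizedRationalProofs
import Literature.AlgebraicGeometry.Resolution.HenselizedFunctionFieldsReduction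
import HarnessLib

/-!
# The generalized stability theorem over a trivially valued ground field: trust base (Kuhlmann 2010, Thm. 1.1)

Topic: `Literature/AlgebraicGeometry/Resolution` (valued function fields). Top-level assembly of
the decomposition of the named fact `Kuhlmann2010Stability` (`ValuationDefect.lean`) = F.-V.
Kuhlmann, *Elimination of ramification I: The generalized stability theorem*, Trans. AMS 362
(2010) 5697–5727 = arXiv:1003.5678, **Thm. 1.1** ("Let `(F|K,v)` be a valued function field
without transcendence defect. If `(K,v)` is a defectless field, then `(F,v)` is a defectless
field") over a trivially valued ground field `K`.

Along the printed proof (§5: Lemma 5.1 `Thm. 1.1 ⇐ (R1)`, Lemma 5.2 `(R1) ⇐ (R2)` via Cor. 2.25,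
Lemma 5.3 `(R2) ⇐ (R3)`, Lemma 5.4 `(R3) ⇐ (R4)`, and the proof of (R4) on pp. 19–20 from
Prop. 2.18, Prop. 3.1, Lemma 2.27, Lemma 5.5 and Cor. 4.2) every step is now PROVED in this
directory except the three normal forms of §4 that carry Cor. 4.2:

* `Kuhlmann2010Prop46ValueIndex` (`NormalDegreePDefectlessVTGalois.lean`) — Prop. 4.6, the mixed
  characteristic value-transcendental case: `(vE:vF) = p` (Kummer normal form, §4.1);
* `Kuhlmann2010GaloisResidueDegreeEqChar` (`GaloisDegreePDefectless.lean`) — Prop. 4.12, the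
  equal characteristic residue-transcendental case: `[Ē:F̄] = p` (Artin–Schreier normal form over
  a lifted Frobenius-closed basis, §§4.2–4.3);
* `Kuhlmann2010Prop413ResidueDegree` (`NormalDegreePDefectlessGalois.lean`) — Prop. 4.13 (with
  Lemma 4.11), the mixed characteristic residue-transcendental case: `[Ē:F̄] = p` (Kummer normal
  form over a lifted Frobenius-closed basis, §§4.2–4.3).

This file records that trust base as ONE implication, so that the discharge
`Kuhlmann2010Stability_holds` is a one-line application once the three facts are proved.

## Content (PROVED)

* `Kuhlmann2010Stability.of_leaves` — **Thm. 1.1 (trivially valued ground field) from Props.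
  4.6, 4.12, 4.13**: `Kuhlmann2010Stability.of_descent_of_rankOne'`
  (`GeneralizedStabilityReductionProofs.lean`: Cor. 2.25 `Kuhlmann2010DefectlessDescent_holds`,
  the fundamental inequality, Cor. 2.6, Cor. 2.16, Lemmas 5.1, 5.3, 5.4) applied to
  (R4) in rank one for a value-transcendental generator —
  `Kuhlmann2010StabilityRankOneValueTranscendental.of_ostrowski_of_immediateExt`
  (`GeneralizedStabilityRankOneVTReduced.lean`) with Ostrowski's lemma
  (`Kuhlmann2010OstrowskiLemma_holds`) and the italicized statement of §5 for `K(x)^h` from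
  Prop. 4.6 (`Kuhlmann2010HenselizedRationalImmediateExt.of_prop46`,
  `HenselizedRationalArtinSchreier.lean`, Prop. 4.5 being proved there) — and for a
  residue-transcendental generator —
  `Kuhlmann2010StabilityRankOneResidueTranscendental.of_ostrowski_of_galois`
  (`GeneralizedStabilityRankOneRTAssembly.lean`) with Ostrowski's lemma, Lemma 5.5 / Prop. 2.18
  (`Kuhlmann2010TameTowerReduction_holds`) and Cor. 4.2 from Props. 4.12–4.13
  (`Kuhlmann2010GaloisDegreePDefectless.of_residueDegree`, `GaloisDegreePDefectless.lean`).

## Sources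

* F.-V. Kuhlmann, *Elimination of ramification I: The generalized stability theorem*, Trans.
  Amer. Math. Soc. 362 (2010) 5697–5727 = arXiv:1003.5678: Thm. 1.1, §4 (Cor. 4.2, Props. 4.6,
  4.12, 4.13), §5 (Lemmas 5.1–5.5 and the proof of Thm. 1.1, pp. 18–20). [Kuhlmann2010]
-/

namespace Literature.AlgebraicGeometry.Resolution

universe u

/-- **Kuhlmann 2010, Thm. 1.1 over a trivially valued ground field, from the three normal forms
of §4** (Prop. 4.6: `Kuhlmann2010Prop46ValueIndex`; Prop. 4.12: `Kuhlmann2010GaloisResidueDegreeEqChar`;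
Prop. 4.13: `Kuhlmann2010Prop413ResidueDegree`), everything else along the printed proof
(§5, Lemmas 5.1–5.5, Cor. 2.25, Prop. 2.18, Prop. 3.1, Lemma 2.27, Prop. 4.5, Ostrowski's lemma,
the fundamental inequality) being PROVED in this directory. PROVED.
[cite: Kuhlmann2010, Thm. 1.1 with Section 5 (pp. 18–20) and Cor. 4.2] -/
theorem Kuhlmann2010Stability.of_leaves (h46 : Kuhlmann2010Prop46ValueIndex.{u})
    (h412 : Kuhlmann2010GaloisResidueDegreeEqChar.{u})
    (h413 : Kuhlmann2010Prop413ResidueDegree.{u}) : Kuhlmann2010Stability.{u} :=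
  Kuhlmann2010Stability.of_descent_of_rankOne' Kuhlmann2010DefectlessDescent_holds
    (Kuhlmann2010StabilityRankOneValueTranscendental.of_ostrowski_of_immediateExt
      Kuhlmann2010OstrowskiLemma_holds (Kuhlmann2010HenselizedRationalImmediateExt.of_prop46 h46))
    (Kuhlmann2010StabilityRankOneResidueTranscendental.of_ostrowski_of_galois
      Kuhlmann2010OstrowskiLemma_holds Kuhlmann2010TameTowerReduction_holds
      (Kuhlmann2010GaloisDegreePDefectless.of_residueDegree h412 h413))

end Literature.AlgebraicGeometry.Resolution
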